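import Summits.AnomalousDissipation.AnomalousDissipation.Theorems.TwoAndHalfDTwohalfdNegRegularCondensate
import Summits.AnomalousDissipation.AnomalousDissipation.Theorems.TwoAndHalfDTwohalfdNegFiniteModeTruncationPath
import Summits.AnomalousDissipation.AnomalousDissipation.Theorems.TwoAndHalfDTwohalfdNegFiniteModeSupEnergy
import Summits.AnomalousDissipation.AnomalousDissipation.Theorems.TwoAndHalfDTwohalfdNegFiniteModeLowModeLipschitz
import Summits.AnomalousDissipation.AnomalousDissipation.Theorems.TwoAndHalfDTwohalfdNegFiniteModeSelection
import Literature.Analysis.FluidPDE.LerayHopfRestartTorus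

/-!
# Finite-mode condensation kills the steady-source scalar anomaly (crux `TwoAndHalfD.TwohalfdNeg`, stmt-AnomalousDissipation-0211)

Line `log-kantorovich-enstrophy-transfer`, lead c7, wave 3.  The INTRINSIC corollary of the regular-condensate theorem
(`RegularCondensate.scalarNoAnomaly_of_regularCondensate`, p135386): no comparison flow is prescribed; the hypothesis is
that the planar kinetic energy asymptotically lives in finitely many Fourier modes,

  `∃ K, ⟨∫_{T²} ‖v_j(t) − P_K v_j(t)‖²⟩ → 0`   (`limsup`-mean; `P_K = Torus.fourierTruncate K`),

with ARBITRARY dynamics of the low modes (chaotic, quasi-periodic, drifting condensates …).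

* `scalarNoAnomaly_of_finiteModeCondensate` (planar form): `g`, `h` smooth mean-zero steady force/source, `ν_j → 0`,
  `v_j` global Leray–Hopf with `ν`-uniformly bounded `limsup`-mean ENERGY, `θ_j` global weak sourced scalars with bounded
  `limsup`-mean variance, finite-mode condensation ⇒ `⟨ν_j‖∇θ_j‖²⟩ → 0`.
* `twohalfdNeg_family_of_finiteModeCondensate` (crux form): the crux `TwohalfdNeg` restricted to bounded-energy
  `x₃`-invariant global Leray–Hopf families whose planar section condenses onto finitely many modes.

PROOF.  The block architecture of the regular-condensate theorem with the comparison flow `W_j = P_K v_j` CLAMPED TO THE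
SELECTED BLOCK: the selection (`stub_fmSelection`) also controls the velocity energy mass and the starting energy on the
block, the Leray–Hopf energy inequality from the (a.e. good) starting time gives a uniform energy bound on the block
(`stub_fmSupEnergy`), on which the low-mode paths are uniformly Lipschitz in space–time (`stub_fmLowModeLipschitz`: the
Galerkin-tested Leray–Hopf identity bounds the speed of every retained Fourier coefficient by `C(K)(R + κ₀√R + ‖g‖₂)`);
the rest is the landed pipeline `stub_rcRestart` / `stub_rcLevel` / `stub_rcArzelaAscoli` / `stub_rcWeakLimit` /
`stub_rcLimit` / `stub_rcContradiction`.  After it the certified perimeter of the crux contains every family whose planar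
flow is asymptotically FINITE-DIMENSIONAL in `L²`; an `X`-witness must keep non-vanishing energy outside every finite set
of Fourier modes (for every `K`, `limsup_j ⟨‖P_{>K}v_j‖²⟩ > 0` along its anomalous subsequence) — and, by c5 §2.3,
a merely uniformly small tail is not excluded.  Supports stmt-AnomalousDissipation-0211; tools stub `stub_fmCertificate`.
-/

namespace Summit.AnomalousDissipation.AnomalousDissipation.Theorems.TwohalfdNeg.FiniteModeCondensate

open MeasureTheory Filter Topology Set
open scoped ENNReal NNReal InnerProductSpace
open Literature.Analysis.FunctionSpaces Literature.Analysis.FluidPDE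
open Summit.AnomalousDissipation.AnomalousDissipation.Theorems.TwohalfdNeg
open Summit.AnomalousDissipation.AnomalousDissipation.Theorems.TwohalfdNeg.RegularCondensate

set_option linter.dupNamespace false

/-! ## The planar finite-mode condensation theorem -/

/-- **Finite-mode condensation kills the scalar anomaly (planar form).** `g` smooth mean-zero steady force, `h`
smooth mean-zero steady source, a truncation level `K`; `ν_j > 0`, `ν_j → 0`; `v_j` global Leray–Hopf solutions of
the planar Navier–Stokes equations forced by `g` (any `L²` data) with `ν`-uniformly bounded `limsup`-mean energy;
`θ_j` global weak solutions of `∂ₜθ + v_j·∇θ = ν_jΔθ + h` from `L²` data with `ν`-uniformly bounded `limsup`-mean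
variance; FINITE-MODE CONDENSATION `⟨∫‖v_j − P_K v_j‖²⟩ → 0`.  THEN `⟨ν_j‖∇θ_j‖²⟩ → 0`. [folklore] -/
theorem scalarNoAnomaly_of_finiteModeCondensate :
    ∀ (g : UnitAddTorus (Fin 2) → EuclideanSpace ℝ (Fin 2)) (h : UnitAddTorus (Fin 2) → ℝ) (K : ℕ),
      Torus.IsSmooth g → Torus.HasZeroMean g → Torus.IsSmooth h → Torus.HasZeroMean h →
      ∀ (ν : ℕ → ℝ) (v₀ : ℕ → UnitAddTorus (Fin 2) → EuclideanSpace ℝ (Fin 2))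
        (v : ℕ → ℝ → UnitAddTorus (Fin 2) → EuclideanSpace ℝ (Fin 2))
        (θ₀ : ℕ → UnitAddTorus (Fin 2) → ℝ) (θ : ℕ → ℝ → UnitAddTorus (Fin 2) → ℝ),
        (∀ j, 0 < ν j) → Tendsto ν atTop (𝓝 0) →
        (∀ j, Torus.IsGlobalLerayHopf (ν j) (fun _ => g) (v₀ j) (v j)) →
        (∃ E : ℝ, ∀ j, meanEnergy (v j) ≤ E) →
        Tendsto (fun j => longTimeAvgSup (fun t =>
          ∫ x, ‖v j t x - Torus.fourierTruncate K (v j t) x‖ ^ 2)) atTop (𝓝 0) →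
        (∀ j, MemLp (θ₀ j) 2 volume) →
        (∀ j, Torus.IsWeakScalarTransportForced (ν j) (v j) (fun _ => h) (θ₀ j) (θ j)) →
        (∃ E : ℝ, ∀ j, longTimeAvgSup (fun t => Torus.scalarL2Sq (θ j t)) ≤ E) →
        Tendsto (fun j => longTimeAvgSup (fun t => ν j * (Torus.eScalarGradNormSq (θ j t)).toReal))
          atTop (𝓝 0) := by
  intro g h K hgs hgz hhs hhz ν v₀ v θ₀ θ hν hν0 hLH hEvex hfluct hθ₀ hθw hEθ
  obtain ⟨E, hE⟩ := hEθ
  obtain ⟨Ev, hEv⟩ := hEvex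
  by_contra hnt
  -- Step 0: an anomaly floor along a subsequence
  have hD0 : ∀ j, 0 ≤ longTimeAvgSup (fun t => ν j * (Torus.eScalarGradNormSq (θ j t)).toReal) :=
    fun j => longTimeAvgSup_nonneg fun t => mul_nonneg (hν j).le ENNReal.toReal_nonneg
  have hfreq : ∃ ε : ℝ, 0 < ε ∧ ∃ᶠ j in atTop,
      ε ≤ longTimeAvgSup (fun t => ν j * (Torus.eScalarGradNormSq (θ j t)).toReal) := by
    by_contra hall
    push Not at hall
    apply hnt
    rw [tendsto_order]
    exact ⟨fun b hb => Eventually.of_forall fun j => hb.trans_le (hD0 j), fun b hb => hall b hb⟩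
  obtain ⟨ε', hε', hfr⟩ := hfreq
  obtain ⟨φ, hφ, hφε⟩ := extraction_of_frequently_atTop hfr
  -- Step 1: constants
  set ε : ℝ := ε' / 3 with hε_def
  have hε : 0 < ε := by positivity
  have hE0 : 0 ≤ E :=
    le_trans (longTimeAvgSup_nonneg fun t => integral_nonneg fun _ => sq_nonneg _) (hE 0)
  have hEv0 : 0 ≤ Ev := by
    have h0 := hEv 0
    rw [meanEnergy_eq_longTimeAvgSup] at h0
    exact le_trans (longTimeAvgSup_nonneg fun t => integral_nonneg fun _ => sq_nonneg _) h0
  set Eθ : ℝ := E + 1 with hEθ_def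
  have hEθ : 0 < Eθ := by positivity
  set Ev' : ℝ := Ev + 1 with hEv'_def
  have hEv' : 0 < Ev' := by positivity
  have hH0 : 0 ≤ ∫ x, h x ^ 2 := integral_nonneg fun _ => sq_nonneg _
  have hG0 : 0 ≤ ∫ x, ‖g x‖ ^ 2 := integral_nonneg fun _ => sq_nonneg _
  set lam : ℝ := 256 * (∫ x, h x ^ 2) * Eθ / ε ^ 2 + 8 with hlam_def
  have hlam : 0 < lam := by positivity
  set c : ℝ := ε / 2 with hc_def
  have hc : 0 < c := by positivity
  set Λ : ℝ := lam * Eθ / 2 with hΛ_def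
  have hΛ : 0 ≤ Λ := by positivity
  set S₀ : ℝ := 2 * Λ * (c ^ 2 + 8 * (∫ x, h x ^ 2) * Λ) / c ^ 3 with hS₀_def
  have hS₀ : 0 ≤ S₀ := by positivity
  set S : ℝ := S₀ + 1 with hS_def
  have hS : 0 < S := by positivity
  -- a viscosity ceiling along the family
  obtain ⟨κ₁, hκ₁⟩ := hν0.bddAbove_range
  set κ₀ : ℝ := |κ₁| + 1 with hκ₀_def
  have hκ₀ : 0 < κ₀ := by positivity
  have hνle : ∀ j, ν j ≤ κ₀ := fun j =>
    le_trans (hκ₁ ⟨j, rfl⟩) (le_trans (le_abs_self _) (le_add_of_nonneg_right zero_le_one))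
  -- block energy radius and the uniform low-mode Lipschitz constant
  set R : ℝ := lam * Ev' + S * (∫ x, ‖g x‖ ^ 2) + lam * Ev' * S with hR_def
  have hR : 0 ≤ R := by positivity
  obtain ⟨L', hL'⟩ := stub_fmLowModeLipschitz K R κ₀ g hR hκ₀ hgs
  -- fluctuation tolerances along the subsequence
  have hF0 : ∀ j, 0 ≤ longTimeAvgSup (fun t => ∫ x, ‖v j t x - Torus.fourierTruncate K (v j t) x‖ ^ 2) :=
    fun j => longTimeAvgSup_nonneg fun t => integral_nonneg fun _ => sq_nonneg _
  set δ : ℕ → ℝ := fun k =>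
    longTimeAvgSup (fun t => ∫ x, ‖v (φ k) t x - Torus.fourierTruncate K (v (φ k) t) x‖ ^ 2) +
      1 / ((k : ℝ) + 1) with hδ_def
  have hδ0 : ∀ k, 0 < δ k := fun k => add_pos_of_nonneg_of_pos (hF0 _) (by positivity)
  have hδlim : Tendsto δ atTop (𝓝 0) := by
    have h1 : Tendsto (fun k => longTimeAvgSup
        (fun t => ∫ x, ‖v (φ k) t x - Torus.fourierTruncate K (v (φ k) t) x‖ ^ 2)) atTop (𝓝 0) :=
      hfluct.comp hφ.tendsto_atTop
    have h2 := h1.add (tendsto_one_div_add_atTop_nhds_zero_nat (𝕜 := ℝ))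
    rw [add_zero] at h2
    exact h2
  -- block constants
  set Cv : ℝ := lam * Eθ * S with hCv_def
  set Cz : ℝ := lam * Eθ with hCz_def
  set C₁ : ℝ := Cz + (∫ x, h x ^ 2) * S + Cv with hC₁_def
  -- Step 2: at every level, a restart-good, energy-good selected block
  have hblock : ∀ k, ∃ a : ℝ,
      ((MemLp (θ (φ k) a) 2 volume ∧ Torus.IsWeakScalarTransportForced (ν (φ k))
        (fun t => v (φ k) (a + t)) (fun _ => h) (θ (φ k) a) (fun t => θ (φ k) (a + t))) ∧
        (∀ t, a ≤ t → Torus.kineticEnergy (v (φ k) t) +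
          ν (φ k) * (∫⁻ τ in Ioo a t, Torus.eGradNormSq (v (φ k) τ)).toReal ≤
            Torus.kineticEnergy (v (φ k) a) + ∫ τ in a..t, ∫ x, inner ℝ (g x) (v (φ k) τ x))) ∧
      0 < a ∧
      ε / 2 * S ≤ ∫ t in Ioc a (a + S), ∫ x, θ (φ k) t x * h x ∧
      ∫ t in Ioc a (a + S), Torus.scalarL2Sq (θ (φ k) t) ≤ lam * Eθ * S ∧
      ∫ t in Ioc a (a + S), ∫ x, ‖v (φ k) t x - Torus.fourierTruncate K (v (φ k) t) x‖ ^ 2 ≤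
        lam * δ k * S ∧
      Torus.scalarL2Sq (θ (φ k) a) ≤ lam * Eθ ∧
      ∫ t in Ioc a (a + S), ∫ x, ‖v (φ k) t x‖ ^ 2 ≤ lam * Ev' * S ∧
      ∫ x, ‖v (φ k) a x‖ ^ 2 ≤ lam * Ev' := by
    intro k
    have hG1 := stub_rcRestart (ν (φ k)) (v (φ k)) h (θ₀ (φ k)) (θ (φ k)) hhs (hθ₀ _) (hθw _)
    have hG2 := (hLH (φ k)).ae_energy_ineq_from
    have hG : ∀ᵐ a ∂(volume.restrict (Ioi (0 : ℝ))),
        a ∈ {a : ℝ | (MemLp (θ (φ k) a) 2 volume ∧ Torus.IsWeakScalarTransportForced (ν (φ k))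
          (fun t => v (φ k) (a + t)) (fun _ => h) (θ (φ k) a) (fun t => θ (φ k) (a + t))) ∧
          (∀ t, a ≤ t → Torus.kineticEnergy (v (φ k) t) +
            ν (φ k) * (∫⁻ τ in Ioo a t, Torus.eGradNormSq (v (φ k) τ)).toReal ≤
              Torus.kineticEnergy (v (φ k) a) + ∫ τ in a..t, ∫ x, inner ℝ (g x) (v (φ k) τ x))} := by
      filter_upwards [hG1, ae_restrict_of_ae (s := Ioi (0 : ℝ)) hG2,
        ae_restrict_mem measurableSet_Ioi] with a ha1 ha2 ha0
      exact ⟨ha1, fun t hat => ha2 ha0 t hat⟩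
    have hpath := stub_fmTruncationPath (ν (φ k)) K g (v₀ (φ k)) (v (φ k)) (hν _) hgs hgz (hLH _)
    obtain ⟨B, hB⟩ := hpath.2
    have hfloor : 2 * ε < longTimeAvgSup
        (fun t => ν (φ k) * (Torus.eScalarGradNormSq (θ (φ k) t)).toReal) := by
      have := hφε k
      rw [hε_def]
      linarith
    have hvar : longTimeAvgSup (fun t => Torus.scalarL2Sq (θ (φ k) t)) < Eθ := by
      rw [hEθ_def]; linarith [hE (φ k)]
    have hen : longTimeAvgSup (fun t => ∫ x, ‖v (φ k) t x‖ ^ 2) < Ev' := by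
      have h0 := hEv (φ k)
      rw [meanEnergy_eq_longTimeAvgSup] at h0
      rw [hEv'_def]; linarith
    have hfl : longTimeAvgSup
        (fun t => ∫ x, ‖v (φ k) t x - Torus.fourierTruncate K (v (φ k) t) x‖ ^ 2) < δ k := by
      rw [hδ_def]; simp only; linarith [one_div_pos.2 (by positivity : (0 : ℝ) < (k : ℝ) + 1)]
    obtain ⟨a, haG, ha0, hpow, hvm, hfm, hz, hve, hze⟩ := stub_fmSelection (ν (φ k)) g (v₀ (φ k)) (v (φ k))
      (fun t => Torus.fourierTruncate K (v (φ k) t)) h (θ₀ (φ k)) (θ (φ k)) _ ε Eθ Ev' (δ k) S B (hν _) hgs hgz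
      (hLH _) hpath.1 hB hhs hhz (hθ₀ _) (hθw _) hG hε hS (hδ0 k) hfloor hvar hen hfl
    exact ⟨a, haG, ha0, hpow, hvm, hfm, hz, hve, hze⟩
  choose a ha using hblock
  -- Step 3: uniform block energy, low-mode Lipschitz package, level packages
  have hsup : ∀ k, ∀ t ∈ Icc (a k) (a k + S), ∫ x, ‖v (φ k) t x‖ ^ 2 ≤ R := fun k =>
    stub_fmSupEnergy (ν (φ k)) (a k) S (lam * Ev' * S) (lam * Ev') g (v₀ (φ k)) (v (φ k)) (hν _)
      (ha k).2.1 hS hgs (hLH _) (ha k).1.2 (ha k).2.2.2.2.2.2.1 (ha k).2.2.2.2.2.2.2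
  -- the block-clamped low-mode comparison flows (shifted and unshifted)
  set Ws : ℕ → ℝ → UnitAddTorus (Fin 2) → EuclideanSpace ℝ (Fin 2) :=
    fun k t x => Torus.fourierTruncate K (v (φ k) (a k + min (max t 0) S)) x with hWs_def
  set Wu : ℕ → ℝ → UnitAddTorus (Fin 2) → EuclideanSpace ℝ (Fin 2) :=
    fun k t x => Torus.fourierTruncate K (v (φ k) (a k + min (max (t - a k) 0) S)) x with hWu_def
  have hlip : ∀ k, LipschitzWith L' (Function.uncurry (Ws k)) ∧ (∀ t x, ‖Ws k t x‖ ≤ L') ∧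
      ∀ t, Torus.IsWeaklyDivFree (Ws k t) := fun k =>
    hL' (ν (φ k)) (a k) S (v₀ (φ k)) (v (φ k)) (hν _) (hνle _) (ha k).2.1 hS (hLH _) (hsup k)
  have hWu_shift : ∀ k t, Wu k (a k + t) = Ws k t := fun k t => by
    simp only [hWu_def, hWs_def, add_sub_cancel_left]
  have hWu_eq : ∀ k, Function.uncurry (Wu k) = Function.uncurry (Ws k) ∘ fun p => (p.1 - a k, p.2) := by
    intro k
    funext p
    show Wu k p.1 p.2 = Ws k (p.1 - a k) p.2
    rw [← hWu_shift k (p.1 - a k), add_sub_cancel]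
  have hWuc : ∀ k, Continuous (Function.uncurry (Wu k)) := fun k => by
    rw [hWu_eq k]
    exact (hlip k).1.continuous.comp (by fun_prop)
  have hWubd : ∀ k t x, ‖Wu k t x‖ ≤ (L' : ℝ) := fun k t x => by
    have := (hlip k).2.1 (t - a k) x
    rwa [← hWu_shift k (t - a k), add_sub_cancel] at this
  -- the fluctuation mass of the clamped flow on the block is that of the truncation
  have hfm' : ∀ k, ∫ t in Ioc (a k) (a k + S), ∫ x, ‖v (φ k) t x - Wu k t x‖ ^ 2 ≤ lam * δ k * S := by
    intro k
    have heq : ∫ t in Ioc (a k) (a k + S), ∫ x, ‖v (φ k) t x - Wu k t x‖ ^ 2 =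
        ∫ t in Ioc (a k) (a k + S), ∫ x, ‖v (φ k) t x - Torus.fourierTruncate K (v (φ k) t) x‖ ^ 2 := by
      refine setIntegral_congr_fun measurableSet_Ioc fun t ht => ?_
      have hcl : a k + min (max (t - a k) 0) S = t := by
        rw [max_eq_left (by linarith [ht.1]), min_eq_left (by linarith [ht.2])]
        ring
      simp only [hWu_def, hcl]
    rw [heq]
    exact (ha k).2.2.2.2.1
  have hlevel := fun k => stub_rcLevel (ν (φ k)) (a k) S L' Cv (lam * δ k * S) Cz g (v₀ (φ k))
    (v (φ k)) (Wu k) h (θ₀ (φ k)) (θ (φ k)) (hν _) (ha k).2.1 hS hgs hgz (hLH _) (hWuc k) (hWubd k)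
    hhs (hθ₀ _) (hθw _) (ha k).1.1.1 (ha k).1.1.2 (ha k).2.2.2.1 (hfm' k) (ha k).2.2.2.2.2.1
  -- restarted sequences
  set ϑ : ℕ → ℝ → UnitAddTorus (Fin 2) → ℝ := fun k t => θ (φ k) (a k + t) with hϑ_def
  set ϑ₀ : ℕ → UnitAddTorus (Fin 2) → ℝ := fun k => θ (φ k) (a k) with hϑ₀_def
  set vs : ℕ → ℝ → UnitAddTorus (Fin 2) → EuclideanSpace ℝ (Fin 2) := fun k t => v (φ k) (a k + t)
    with hvs_def
  -- Step 4: Arzelà–Ascoli for the clamped low-mode flows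
  obtain ⟨φ₁, W', hφ₁, hW'lip, hW'bd, hW'div, hunif⟩ := stub_rcArzelaAscoli L' S Ws hS
    (fun k => (hlip k).1) (fun k t x => (hlip k).2.1 t x) (fun k t => (hlip k).2.2 t)
  -- Step 5: joint weak limits along `φ₁`
  obtain ⟨φ₂, Θ, Θ₀, hφ₂, hΘm, hΘi, hΘbd, hΘsl, hΘ₀m, hΘ₀bd, hconv, hconv₀⟩ :=
    stub_rcWeakLimit S Cv Cz C₁ (fun n => ϑ (φ₁ n)) (fun n => ϑ₀ (φ₁ n)) hS
      (fun n => (hlevel (φ₁ n)).2.1) (fun n => (hlevel (φ₁ n)).2.2.1)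
      (fun n => (hlevel (φ₁ n)).2.2.2.1) (fun n => (hlevel (φ₁ n)).2.2.2.2.1)
      (fun n => (ha (φ₁ n)).1.1.1) (fun n => (ha (φ₁ n)).2.2.2.2.2.1)
  -- Step 6: the limit solves the sourced transport equation
  set ψ : ℕ → ℕ := fun n => φ₁ (φ₂ n) with hψ_def
  have hψ : Tendsto ψ atTop atTop := hφ₁.tendsto_atTop.comp hφ₂.tendsto_atTop
  have hνlim : Tendsto (fun n => ν (φ (ψ n))) atTop (𝓝 0) :=
    (hν0.comp hφ.tendsto_atTop).comp hψ
  have hfluct_lim : Tendsto (fun n => ∫⁻ p, ‖vs (ψ n) p.1 p.2 - Ws (ψ n) p.1 p.2‖ₑ ^ 2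
      ∂(((volume : Measure ℝ).restrict (Ioo 0 S)).prod volume)) atTop (𝓝 0) := by
    have hup : Tendsto (fun n => ENNReal.ofReal (lam * δ (ψ n) * S)) atTop (𝓝 0) := by
      have h1 : Tendsto (fun n => lam * δ (ψ n) * S) atTop (𝓝 (lam * 0 * S)) :=
        ((hδlim.comp hψ).const_mul lam).mul_const S
      rw [mul_zero, zero_mul] at h1
      simpa using ENNReal.tendsto_ofReal h1
    refine tendsto_of_tendsto_of_tendsto_of_le_of_le tendsto_const_nhds hup (fun n => zero_le) fun n => ?_
    have h6 := (hlevel (ψ n)).2.2.2.2.2.1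
    simp only [hWu_shift] at h6
    exact h6
  have hclass : Torus.IsWeakScalarTransportForcedOn S 0 W' (fun _ => h) Θ₀ Θ :=
    stub_rcLimit S L' Cv C₁ h (fun n => ν (φ (ψ n))) (fun n => vs (ψ n)) (fun n => Ws (ψ n)) W'
      (fun n => ϑ₀ (ψ n)) (fun n => ϑ (ψ n)) Θ₀ Θ hS hhs hνlim (fun n => (ha (ψ n)).1.1.1)
      (fun n => (hlevel (ψ n)).1) (fun n => (hlevel (ψ n)).2.2.1) (fun n => (hlevel (ψ n)).2.2.2.1)
      (fun n => (hlip (ψ n)).1.continuous) (fun n t x => (hlip (ψ n)).2.1 t x) hfluct_lim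
      hW'lip.continuous hW'bd hW'div (fun d hd => hφ₂.tendsto_atTop.eventually (hunif d hd))
      hΘm hΘi hΘsl hΘ₀m hconv hconv₀
  -- Step 7: power and level of the limit
  obtain ⟨Ch, hCh⟩ := Torus.exists_forall_norm_le_of_continuous hhs.continuous
  have hpowlim : c * S ≤
      ∫ p, Θ p.1 p.2 * h p.2 ∂(((volume : Measure ℝ).restrict (Ioo 0 S)).prod volume) := by
    have ht := hconv (fun p => h p.2)
      ((hhs.continuous.comp continuous_snd).aestronglyMeasurable) ⟨Ch, fun p => by
        rw [← Real.norm_eq_abs]; exact hCh p.2⟩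
    refine ge_of_tendsto ht (Eventually.of_forall fun n => ?_)
    show c * S ≤ ∫ p, ϑ (ψ n) p.1 p.2 * h p.2 ∂(((volume : Measure ℝ).restrict (Ioo 0 S)).prod volume)
    rw [hc_def, (hlevel (ψ n)).2.2.2.2.2.2]
    exact (ha (ψ n)).2.2.1
  have hlevlim : ∫ p, Θ p.1 p.2 ^ 2 ∂(((volume : Measure ℝ).restrict (Ioo 0 S)).prod volume) ≤
      2 * Λ * S := by
    have : Cv = 2 * Λ * S := by rw [hCv_def, hΛ_def]; ring
    rw [← this]
    exact hΘbd
  -- Step 8: the endgame bound contradicts the choice of `S`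
  have hbound := stub_rcContradiction S c Λ L' h W' Θ₀ Θ hS hc hΛ hhs hΘ₀m hW'lip.continuous
    (lipschitzWith_slice hW'lip) hclass hΘm hΘi hlevlim hpowlim
  have : S ≤ S₀ := hbound
  linarith

/-! ## The crux on families condensing onto finitely many modes -/

/-- **The crux `TwohalfdNeg` on finite-mode condensing families.** For an `x₃`-invariant smooth divergence-free
mean-zero steady force `f` on `T³`, a truncation level `K`, and a family of `x₃`-invariant global Leray–Hopf
solutions `u_j` of NS_{ν_j}, `ν_j → 0`, arbitrary `L²` data, with `ν`-uniformly bounded `limsup`-mean energy, WHOSE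
PLANAR SECTION CONDENSES ONTO THE FOURIER MODES `|k| ≤ K` in `limsup`-mean `L²` —
`⟨∫_{T²}‖σ_j(t) − P_K σ_j(t)‖²⟩ → 0`, `σ_j(t)(y) = π_E(u_j(t, σ(y)))` the planar velocity on the section — the mean
dissipation tends to `0`.  Reduction S1', Alexakis–Doering S2 and `scalarNoAnomaly_of_finiteModeCondensate` (for
`t ≠ 0` the section IS the planar Leray–Hopf flow of the reduction). [folklore] -/
theorem twohalfdNeg_family_of_finiteModeCondensate :
    ∀ f : UnitAddTorus (Fin 3) → EuclideanSpace ℝ (Fin 3),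
      (∀ (s : UnitAddCircle) (x : UnitAddTorus (Fin 3)), f (x + Pi.single (2 : Fin 3) s) = f x) →
      Torus.IsSmooth f → Torus.IsDivFree f → Torus.HasZeroMean f →
      ∀ (K : ℕ) (ν : ℕ → ℝ) (u₀ : ℕ → UnitAddTorus (Fin 3) → EuclideanSpace ℝ (Fin 3))
        (u : ℕ → ℝ → UnitAddTorus (Fin 3) → EuclideanSpace ℝ (Fin 3)),
        (∀ j, 0 < ν j) → Tendsto ν atTop (𝓝 0) →
        (∀ j, Torus.IsGlobalLerayHopf (ν j) (fun _ => f) (u₀ j) (u j)) →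
        (∀ j (t : ℝ) (s : UnitAddCircle) (x : UnitAddTorus (Fin 3)),
          u j t (x + Pi.single (2 : Fin 3) s) = u j t x) →
        (∃ E : ℝ, ∀ j, meanEnergy (u j) ≤ E) →
        Tendsto (fun j => longTimeAvgSup (fun t =>
          ∫ y, ‖Torus.planarProjE (u j t (Torus.planarSect y)) -
            Torus.fourierTruncate K (fun y => Torus.planarProjE (u j t (Torus.planarSect y))) y‖ ^ 2))
          atTop (𝓝 0) →
        Tendsto (fun j => meanDissipation (ν j) (u j)) atTop (𝓝 0) := by
  intro f hfinv hfs hfd hfz K ν u₀ u hν hν0 hLH huinv hE hcond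
  obtain ⟨g, h, v₀, v, θ₀, θ, hgs, hgd, hgz, hhs, hhz, -, huv, hvLH, hθ₀, hθw, hEv, hEθ, hsplit⟩ :=
    ReductionOffZero.stub_reductionOffZero f hfinv hfs hfd hfz ν u₀ u hν hLH huinv hE
  have hplanar : Tendsto (fun j => meanDissipation (ν j) (v j)) atTop (𝓝 0) :=
    PlanarNoAnomaly.stub_planarNoAnomaly g hgs hgd hgz ν v₀ v hν hν0 hvLH hEv
  -- the finite-mode condensation hypothesis read on the planar flow
  have hsect : ∀ j (t : ℝ), t ≠ 0 → (fun y => Torus.planarProjE (u j t (Torus.planarSect y))) = v j t := by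
    intro j t ht
    funext y
    rw [huv j t ht, Torus.planarProjE_twoHalf_planarSect]
  have hcond' : Tendsto (fun j => longTimeAvgSup (fun t =>
      ∫ y, ‖v j t y - Torus.fourierTruncate K (v j t) y‖ ^ 2)) atTop (𝓝 0) := by
    refine hcond.congr fun j => ?_
    unfold longTimeAvgSup
    refine limsup_congr ?_
    filter_upwards [eventually_gt_atTop (0 : ℝ)] with T hT
    unfold timeMean
    congr 1
    refine intervalIntegral.integral_congr_ae (Eventually.of_forall fun t ht => ?_)
    rw [Set.uIoc_of_le hT.le] at ht
    have e := hsect j t ht.1.ne'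
    simp only [e]
    refine integral_congr_ae (Eventually.of_forall fun y => ?_)
    simp only
    rw [huv j t ht.1.ne', Torus.planarProjE_twoHalf_planarSect]
  have hscalar : Tendsto (fun j => longTimeAvgSup
      (fun t => ν j * (Torus.eScalarGradNormSq (θ j t)).toReal)) atTop (𝓝 0) :=
    scalarNoAnomaly_of_finiteModeCondensate g h K hgs hgz hhs hhz ν v₀ v θ₀ θ hν hν0 hvLH hEv hcond' hθ₀
      hθw hEθ
  have hsum : Tendsto (fun j => meanDissipation (ν j) (v j) +
      longTimeAvgSup (fun t => ν j * (Torus.eScalarGradNormSq (θ j t)).toReal)) atTop (𝓝 0) := by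
    simpa using hplanar.add hscalar
  exact squeeze_zero (fun j => meanDissipation_nonneg (hν j).le (u j)) hsplit hsum


/-- **Registered tools stub `stub_fmCertificate`** (the finite-mode condensation theorem, registered on
stmt-AnomalousDissipation-0211 with `ledger workitem stub-add`): the planar theorem and the crux on families whose
planar section condenses onto finitely many Fourier modes. [folklore] -/
theorem stub_fmCertificate :
    (∀ (g : UnitAddTorus (Fin 2) → EuclideanSpace ℝ (Fin 2)) (h : UnitAddTorus (Fin 2) → ℝ) (K : ℕ),
      Torus.IsSmooth g → Torus.HasZeroMean g → Torus.IsSmooth h → Torus.HasZeroMean h →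
      ∀ (ν : ℕ → ℝ) (v₀ : ℕ → UnitAddTorus (Fin 2) → EuclideanSpace ℝ (Fin 2))
        (v : ℕ → ℝ → UnitAddTorus (Fin 2) → EuclideanSpace ℝ (Fin 2))
        (θ₀ : ℕ → UnitAddTorus (Fin 2) → ℝ) (θ : ℕ → ℝ → UnitAddTorus (Fin 2) → ℝ),
        (∀ j, 0 < ν j) → Tendsto ν atTop (𝓝 0) →
        (∀ j, Torus.IsGlobalLerayHopf (ν j) (fun _ => g) (v₀ j) (v j)) →
        (∃ E : ℝ, ∀ j, meanEnergy (v j) ≤ E) →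
        Tendsto (fun j => longTimeAvgSup (fun t =>
          ∫ x, ‖v j t x - Torus.fourierTruncate K (v j t) x‖ ^ 2)) atTop (𝓝 0) →
        (∀ j, MemLp (θ₀ j) 2 volume) →
        (∀ j, Torus.IsWeakScalarTransportForced (ν j) (v j) (fun _ => h) (θ₀ j) (θ j)) →
        (∃ E : ℝ, ∀ j, longTimeAvgSup (fun t => Torus.scalarL2Sq (θ j t)) ≤ E) →
        Tendsto (fun j => longTimeAvgSup (fun t => ν j * (Torus.eScalarGradNormSq (θ j t)).toReal))
          atTop (𝓝 0)) ∧
    (∀ f : UnitAddTorus (Fin 3) → EuclideanSpace ℝ (Fin 3),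
      (∀ (s : UnitAddCircle) (x : UnitAddTorus (Fin 3)), f (x + Pi.single (2 : Fin 3) s) = f x) →
      Torus.IsSmooth f → Torus.IsDivFree f → Torus.HasZeroMean f →
      ∀ (K : ℕ) (ν : ℕ → ℝ) (u₀ : ℕ → UnitAddTorus (Fin 3) → EuclideanSpace ℝ (Fin 3))
        (u : ℕ → ℝ → UnitAddTorus (Fin 3) → EuclideanSpace ℝ (Fin 3)),
        (∀ j, 0 < ν j) → Tendsto ν atTop (𝓝 0) →
        (∀ j, Torus.IsGlobalLerayHopf (ν j) (fun _ => f) (u₀ j) (u j)) →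
        (∀ j (t : ℝ) (s : UnitAddCircle) (x : UnitAddTorus (Fin 3)),
          u j t (x + Pi.single (2 : Fin 3) s) = u j t x) →
        (∃ E : ℝ, ∀ j, meanEnergy (u j) ≤ E) →
        Tendsto (fun j => longTimeAvgSup (fun t =>
          ∫ y, ‖Torus.planarProjE (u j t (Torus.planarSect y)) -
            Torus.fourierTruncate K (fun y => Torus.planarProjE (u j t (Torus.planarSect y))) y‖ ^ 2))
          atTop (𝓝 0) →
        Tendsto (fun j => meanDissipation (ν j) (u j)) atTop (𝓝 0)) :=
  ⟨scalarNoAnomaly_of_finiteModeCondensate, twohalfdNeg_family_of_finiteModeCondensate⟩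

end Summit.AnomalousDissipation.AnomalousDissipation.Theorems.TwohalfdNeg.FiniteModeCondensate
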